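import Summits.Ventures.Crystal3D.Theorems.StickyWulffConstantTextureBuildLocalAgreement
import Summits.Ventures.Crystal3D.Theorems.StickyWulffConstantTextureBuildResolutionEnlarged
import HarnessLib

/-!
# Texture build, TB-A: adjacent good cubes agree (the `Mesh.hagree` clause for grid-cube grains)

Assembly of `barlowResolution_enlarged` (…ResolutionEnlarged) with the local agreement lemma
(…LocalAgreement): in the configuration-indexed vocabulary `x : Fin N → E3`,

* `twelve_le_card_filter_of_closePacked` — a ball with a close-packed first shell has (at least) twelve
  balls of `Finset.univ.image x` at distance `1` (bridge `coordination = 12` → the finset count used by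
  `mem_of_perfect_near`);
* `stacking_mem_iff_of_enlarged` — if two enlarged cubes both contain `closedBall (x i₀) (R + 3)` and carry
  there the certification of `barlowResolution_enlarged` (balls on the cube's stacking, close-packed shells),
  the two stackings have the same sites within `R` of `x i₀`;
* `stacking_inter_ball_eq_of_enlarged` — the set form `S₁ ∩ ball y ρ' = S₂ ∩ ball y ρ'` for balls inside
  `closedBall (x i₀) R`, literally the shape of `Mesh.hagree`.
-/

noncomputable section

namespace Summit.Ventures.Crystal3D.Theorems

open Finset Metric Summit.Ventures.Crystal3D
open Literature.MathematicalPhysics.StatisticalMechanics (IsHaggSeq)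
open Summit.Ventures.Crystal3D.Cruxes.TextureLiminf.TexShadow (E3 stacking cube)

/-- Bridge: a close-packed first shell gives twelve balls of the configuration's point set at distance `1`. -/
theorem twelve_le_card_filter_of_closePacked {N : ℕ} {x : Fin N → E3} (hx : IsUnitPacking x) {i : Fin N}
    (h : IsClosePackedShell x i) :
    12 ≤ ((Finset.univ.image x).filter fun y => dist (x i) y = 1).card := by
  classical
  have h12 : (contactNeighbors x i).card = 12 := h.coordination_eq hx
  rw [← h12]
  have hsub : (contactNeighbors x i).image x ⊆ (Finset.univ.image x).filter fun y => dist (x i) y = 1 := by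
    intro y hy
    rw [Finset.mem_image] at hy
    obtain ⟨j, hj, rfl⟩ := hy
    rw [mem_contactNeighbors] at hj
    exact Finset.mem_filter.2 ⟨Finset.mem_image_of_mem _ (Finset.mem_univ _), hj.2⟩
  calc (contactNeighbors x i).card = ((contactNeighbors x i).image x).card :=
        (Finset.card_image_of_injective _ hx.injective).symm
    _ ≤ _ := Finset.card_le_card hsub

/-- **Adjacent good cubes agree.**  Two enlarged cubes carrying the certification of
`barlowResolution_enlarged` and both containing `closedBall (x i₀) (R + 3)` have stackings with the same
sites within `R` of `x i₀`. -/
theorem stacking_mem_iff_of_enlarged {N : ℕ} {x : Fin N → E3} (hx : IsUnitPacking x)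
    {Q₁ Q₂ : Set E3} {L₁ L₂ : E3 ≃ₗᵢ[ℝ] E3} {s₁ s₂ : E3} {σ₁ σ₂ : ℤ → ℤ}
    (hσ₁ : IsHaggSeq σ₁) (hσ₂ : IsHaggSeq σ₂)
    (hst₁ : ∀ i, x i ∈ Q₁ → x i ∈ stacking L₁ s₁ σ₁) (hperf₁ : ∀ i, x i ∈ Q₁ → IsClosePackedShell x i)
    (hst₂ : ∀ i, x i ∈ Q₂ → x i ∈ stacking L₂ s₂ σ₂)
    {i₀ : Fin N} {R : ℝ} (hR : 0 ≤ R)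
    (hQ₁ : Metric.closedBall (x i₀) (R + 3) ⊆ Q₁) (hQ₂ : Metric.closedBall (x i₀) (R + 3) ⊆ Q₂) :
    ∀ z : E3, dist z (x i₀) ≤ R → (z ∈ stacking L₁ s₁ σ₁ ↔ z ∈ stacking L₂ s₂ σ₂) := by
  classical
  set X : Finset E3 := Finset.univ.image x with hX
  have hmemX : ∀ y ∈ X, ∃ i, x i = y := fun y hy => by
    rw [hX, Finset.mem_image] at hy
    obtain ⟨i, -, hi⟩ := hy
    exact ⟨i, hi⟩
  have hp₀ : x i₀ ∈ X := Finset.mem_image_of_mem _ (Finset.mem_univ _)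
  have hin₁ : ∀ y, dist y (x i₀) ≤ R + 3 → y ∈ Q₁ := fun y hy => hQ₁ (Metric.mem_closedBall.2 hy)
  have hin₂ : ∀ y, dist y (x i₀) ≤ R + 3 → y ∈ Q₂ := fun y hy => hQ₂ (Metric.mem_closedBall.2 hy)
  have hS₁ : ∀ y ∈ X, dist y (x i₀) ≤ R + 2 → y ∈ stacking L₁ s₁ σ₁ := by
    intro y hy hd
    obtain ⟨i, rfl⟩ := hmemX y hy
    exact hst₁ i (hin₁ _ (by linarith))
  have hS₂ : ∀ y ∈ X, dist y (x i₀) ≤ R + 2 → y ∈ stacking L₂ s₂ σ₂ := by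
    intro y hy hd
    obtain ⟨i, rfl⟩ := hmemX y hy
    exact hst₂ i (hin₂ _ (by linarith))
  have h12 : ∀ y ∈ X, dist y (x i₀) ≤ R + 1 → 12 ≤ (X.filter fun y' => dist y y' = 1).card := by
    intro y hy hd
    obtain ⟨i, rfl⟩ := hmemX y hy
    exact twelve_le_card_filter_of_closePacked hx (hperf₁ i (hin₁ _ (by linarith)))
  have hp₀S₁ : x i₀ ∈ stacking L₁ s₁ σ₁ := hst₁ i₀ (hin₁ _ (by rw [dist_self]; linarith))
  have hp₀S₂ : x i₀ ∈ stacking L₂ s₂ σ₂ := hst₂ i₀ (hin₂ _ (by rw [dist_self]; linarith))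
  exact mem_iff_mem_of_perfect_near hσ₁ hσ₂ X hp₀ hp₀S₁ hp₀S₂ R hS₁ hS₂ h12

/-- Set form (the shape of `Mesh.hagree`): the two stackings coincide on every ball inside
`closedBall (x i₀) R`. -/
theorem stacking_inter_ball_eq_of_enlarged {N : ℕ} {x : Fin N → E3} (hx : IsUnitPacking x)
    {Q₁ Q₂ : Set E3} {L₁ L₂ : E3 ≃ₗᵢ[ℝ] E3} {s₁ s₂ : E3} {σ₁ σ₂ : ℤ → ℤ}
    (hσ₁ : IsHaggSeq σ₁) (hσ₂ : IsHaggSeq σ₂)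
    (hst₁ : ∀ i, x i ∈ Q₁ → x i ∈ stacking L₁ s₁ σ₁) (hperf₁ : ∀ i, x i ∈ Q₁ → IsClosePackedShell x i)
    (hst₂ : ∀ i, x i ∈ Q₂ → x i ∈ stacking L₂ s₂ σ₂)
    {i₀ : Fin N} {R : ℝ} (hR : 0 ≤ R)
    (hQ₁ : Metric.closedBall (x i₀) (R + 3) ⊆ Q₁) (hQ₂ : Metric.closedBall (x i₀) (R + 3) ⊆ Q₂)
    {y : E3} {ρ' : ℝ} (hy : Metric.ball y ρ' ⊆ Metric.closedBall (x i₀) R) :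
    stacking L₁ s₁ σ₁ ∩ Metric.ball y ρ' = stacking L₂ s₂ σ₂ ∩ Metric.ball y ρ' := by
  have key := stacking_mem_iff_of_enlarged hx hσ₁ hσ₂ hst₁ hperf₁ hst₂ hR hQ₁ hQ₂
  ext z
  simp only [Set.mem_inter_iff]
  constructor
  · rintro ⟨hz, hzb⟩
    exact ⟨(key z (Metric.mem_closedBall.1 (hy hzb))).1 hz, hzb⟩
  · rintro ⟨hz, hzb⟩
    exact ⟨(key z (Metric.mem_closedBall.1 (hy hzb))).2 hz, hzb⟩

end Summit.Ventures.Crystal3D.Theorems
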